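import Mathlib
import Summits.ValiantsHypothesis.ValiantsHypothesis.Theses.ProofCarryingSymmetry
import Summits.ValiantsHypothesis.ValiantsHypothesis.Theorems.ProofCarryingSymmetryRestorationQPPCLayoutIso

/-!
# Route ProofCarryingSymmetry — crux `RestorationQP`, line `registered`: NECESSITY of the provability stub

Part 5 (conclusion) of the necessity programme for stub T′ `stub_invarianceProvableQP'` of the line
`registered` (skeleton `RestorationQP_of : T′ → S2″ → RestorationQP`):

* `invarianceProvableQP_of_restorationQP` — **`RestorationQP → InvarianceProvableQP` (T_gen)**: if
  every diagonally `S_n`-invariant VP family has quasi-polynomial `S_n`-symmetric circuits, then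
  every such family has quasi-polynomial Hrubeš–Tzameret circuits ALL of whose invariance
  identities `C ∘ σ = C`, `σ ∈ S_n`, have quasi-polynomial `P_c(ℂ)` PROOFS — a symmetric circuit,
  laid out as a straight-line program, proves its own symmetry gate by gate
  (`PCR.exists_piCircuit_pcProofs_of_isSymmetric`, parts 1–4).

With the skeleton's composition (T_gen ∧ L ⇒ RestorationQP, W1: VP ⇒ poly-size `PICircuit`s, so
T_gen = W1 ∘ T′) the provability stub is now SANDWICHED: `RestorationQP ⇒ T_gen` and
`T_gen ∧ L ⇒ RestorationQP`; the only content of the line beyond consequences of the crux itself is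
the stability bet S2″ ≡ L.  Everything proved, no named facts.
-/

-- single-problem summit: `Summit.ValiantsHypothesis.ValiantsHypothesis.…` is the namespace by design (D-0017)
set_option linter.dupNamespace false

namespace Summit.ValiantsHypothesis.ValiantsHypothesis.Theorems

open Literature.Computability.AlgebraicComplexity

/-- Size bookkeeping: with `N = 2^((log₂ n + c)^c)`, both `310·(N+3)⁹` and `N·N·(N+2)` are
`≤ 2^((log₂ n + c')^c')` for `c' = c + 6`. [folklore] -/
theorem qp_nine (c : ℕ) : ∃ c' : ℕ, ∀ n : ℕ,
    310 * (2 ^ ((Nat.log 2 n + c) ^ c) + 3) ^ 9 ≤ 2 ^ ((Nat.log 2 n + c') ^ c') ∧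
    2 ^ ((Nat.log 2 n + c) ^ c) * 2 ^ ((Nat.log 2 n + c) ^ c) * (2 ^ ((Nat.log 2 n + c) ^ c) + 2) ≤
      2 ^ ((Nat.log 2 n + c') ^ c') := by
  refine ⟨c + 6, fun n => ?_⟩
  generalize Nat.log 2 n = L
  set M := (L + c) ^ c with hM
  have hM1 : 1 ≤ M := by
    rcases Nat.eq_zero_or_pos c with rfl | hc
    · simp [hM]
    · exact Nat.one_le_pow _ _ (by omega)
  have hN1 : 1 ≤ (2 : ℕ) ^ M := Nat.one_le_two_pow
  -- the exponent
  have hexp : 9 * M + 27 ≤ (L + (c + 6)) ^ (c + 6) := by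
    have hA : M ≤ (L + (c + 6)) ^ c := Nat.pow_le_pow_left (by omega) _
    have hB : 46656 ≤ (L + (c + 6)) ^ 6 :=
      calc (46656 : ℕ) = 6 ^ 6 := by norm_num
        _ ≤ (L + (c + 6)) ^ 6 := Nat.pow_le_pow_left (by omega) _
    calc 9 * M + 27 ≤ 46656 * M := by omega
      _ ≤ (L + (c + 6)) ^ 6 * (L + (c + 6)) ^ c := Nat.mul_le_mul hB hA
      _ = (L + (c + 6)) ^ (c + 6) := by rw [← pow_add, add_comm 6 c]
  have htop : (2 : ℕ) ^ (9 * M + 27) ≤ 2 ^ ((L + (c + 6)) ^ (c + 6)) := Nat.pow_le_pow_right (by norm_num) hexp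
  constructor
  · have h1 : (2 : ℕ) ^ M + 3 ≤ 2 ^ (M + 2) := by
      have : (2 : ℕ) ^ (M + 2) = 2 ^ M * 4 := by rw [pow_add]; norm_num
      omega
    have h2 : ((2 : ℕ) ^ M + 3) ^ 9 ≤ 2 ^ (9 * (M + 2)) := by
      calc ((2 : ℕ) ^ M + 3) ^ 9 ≤ (2 ^ (M + 2)) ^ 9 := Nat.pow_le_pow_left h1 9
        _ = 2 ^ (9 * (M + 2)) := by rw [← pow_mul, mul_comm]
    calc 310 * ((2 : ℕ) ^ M + 3) ^ 9 ≤ 2 ^ 9 * 2 ^ (9 * (M + 2)) := Nat.mul_le_mul (by norm_num) h2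
      _ = 2 ^ (9 * M + 27) := by rw [← pow_add]; congr 1; ring
      _ ≤ 2 ^ ((L + (c + 6)) ^ (c + 6)) := htop
  · have h1 : (2 : ℕ) ^ M + 2 ≤ 2 ^ (M + 2) := by
      have : (2 : ℕ) ^ (M + 2) = 2 ^ M * 4 := by rw [pow_add]; norm_num
      omega
    calc (2 : ℕ) ^ M * 2 ^ M * (2 ^ M + 2) ≤ 2 ^ M * 2 ^ M * 2 ^ (M + 2) := Nat.mul_le_mul_left _ h1
      _ = 2 ^ (3 * M + 2) := by rw [← pow_add, ← pow_add]; congr 1; ring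
      _ ≤ 2 ^ (9 * M + 27) := Nat.pow_le_pow_right (by norm_num) (by omega)
      _ ≤ 2 ^ ((L + (c + 6)) ^ (c + 6)) := htop

/-- **NECESSITY OF THE PROVABILITY STUB: `RestorationQP → InvarianceProvableQP` (T_gen).**  If the
crux holds, every diagonally `S_n`-invariant VP family is computed by Hrubeš–Tzameret circuits of
quasi-polynomial size all of whose invariance identities `C ∘ σ = C`, `σ ∈ S_n`, have
`P_c(ℂ)` proofs of quasi-polynomial size: the `S_n`-symmetric circuit of size
`N ≤ 2^((log₂ n + c)^c)` supplied by the crux, laid out as a straight-line circuit of size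
`≤ N²(N+2)`, proves its own symmetry in size `≤ 310·(N+3)⁹`
(`PCR.exists_piCircuit_pcProofs_of_isSymmetric`).  The conclusion is verbatim the birth stub T_gen
(`InvarianceProvableQP`) of the line, i.e. the conclusion of the registered stub T′
`stub_invarianceProvableQP'`. [folklore] -/
theorem invarianceProvableQP_of_restorationQP :
    Summit.ValiantsHypothesis.ValiantsHypothesis.Theses.ProofCarryingSymmetry.RestorationQP →
    ∀ f : (n : ℕ) → MvPolynomial (Fin n × Fin n) ℂ,
      (∀ (n : ℕ) (σ : Equiv.Perm (Fin n)),
        MvPolynomial.rename (fun x : Fin n × Fin n => σ • x) (f n) = f n) →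
      IsVPFamily f →
      ∃ c : ℕ, ∀ n : ℕ, ∃ C : PICircuit ℂ (Fin n × Fin n),
        C.eval = f n ∧ C.size ≤ 2 ^ ((Nat.log 2 n + c) ^ c) ∧
        ∀ σ : Equiv.Perm (Fin n),
          HasPCProofOfSize (C.rename fun x : Fin n × Fin n => σ • x) C (2 ^ ((Nat.log 2 n + c) ^ c)) := by
  intro h f hinv hVP
  obtain ⟨c, hc⟩ := h f hinv hVP
  obtain ⟨c', hc'⟩ := qp_nine c
  refine ⟨c', fun n => ?_⟩
  obtain ⟨G, hG, D, hsym, hev, hcard⟩ := hc n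
  obtain ⟨C, -, hCev, hCsize, -, hCpc⟩ :=
    PCR.exists_piCircuit_pcProofs_of_isSymmetric (Γ := Equiv.Perm (Fin n)) D hsym () (fun _ => rfl)
  obtain ⟨h9, h3⟩ := hc' n
  refine ⟨C, hCev.trans hev, hCsize.trans ?_, fun σ => (hCpc σ).mono ?_⟩
  · exact (Nat.mul_le_mul (Nat.mul_le_mul hcard hcard) (Nat.add_le_add_right hcard 2)).trans h3
  · exact (Nat.mul_le_mul_left 310 (Nat.pow_le_pow_left (Nat.add_le_add_right hcard 3) 9)).trans h9

/-- **The crux implies the joint conclusion "quasi-polynomial circuits with quasi-polynomial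
invariance proofs AND AC-invariant unfoldings"** — both what T′ and what S2″ are asked to deliver,
for one and the same circuit. [folklore] -/
theorem invarianceProvable_and_acInvariant_of_restorationQP
    (h : Summit.ValiantsHypothesis.ValiantsHypothesis.Theses.ProofCarryingSymmetry.RestorationQP) :
    ∀ f : (n : ℕ) → MvPolynomial (Fin n × Fin n) ℂ,
      (∀ (n : ℕ) (σ : Equiv.Perm (Fin n)),
        MvPolynomial.rename (fun x : Fin n × Fin n => σ • x) (f n) = f n) →
      IsVPFamily f →
      ∃ c : ℕ, ∀ n : ℕ, ∃ C : PICircuit ℂ (Fin n × Fin n),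
        C.eval = f n ∧ C.size ≤ 2 ^ ((Nat.log 2 n + c) ^ c) ∧
        (∀ σ : Equiv.Perm (Fin n),
          HasPCProofOfSize (C.rename fun x : Fin n × Fin n => σ • x) C (2 ^ ((Nat.log 2 n + c) ^ c))) ∧
        ∀ σ : Equiv.Perm (Fin n), ACStability.ACEq (C.rename fun x : Fin n × Fin n => σ • x).unfold C.unfold := by
  intro f hinv hVP
  obtain ⟨c, hc⟩ := h f hinv hVP
  obtain ⟨c', hc'⟩ := qp_nine c
  refine ⟨c', fun n => ?_⟩
  obtain ⟨G, hG, D, hsym, hev, hcard⟩ := hc n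
  obtain ⟨C, -, hCev, hCsize, hCac, hCpc⟩ :=
    PCR.exists_piCircuit_pcProofs_of_isSymmetric (Γ := Equiv.Perm (Fin n)) D hsym () (fun _ => rfl)
  obtain ⟨h9, h3⟩ := hc' n
  refine ⟨C, hCev.trans hev, hCsize.trans ?_, fun σ => (hCpc σ).mono ?_, hCac⟩
  · exact (Nat.mul_le_mul (Nat.mul_le_mul hcard hcard) (Nat.add_le_add_right hcard 2)).trans h3
  · exact (Nat.mul_le_mul_left 310 (Nat.pow_le_pow_left (Nat.add_le_add_right hcard 3) 9)).trans h9

end Summit.ValiantsHypothesis.ValiantsHypothesis.Theorems
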